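import Summits.CriticalPhenomena.CardyFormulaZ2.Theorems.CardyIKTransportIKMixedBoxCrossingQuenchedSquaresFromTall
import Summits.CriticalPhenomena.CardyFormulaZ2.Theorems.CardyIKTransportIKMixedBoxCrossingQuenchedHarris7
import Summits.CriticalPhenomena.CardyFormulaZ2.Theorems.CardyIKTransportIKMixedBoxCrossingQuenchedRSWAssembly
import Summits.CriticalPhenomena.CardyFormulaZ2.Theorems.CardyIKTransportIKMixedBoxCrossingQuenchedLogSupermodular
import Summits.CriticalPhenomena.CardyFormulaZ2.Theorems.CardyIKTransportIKMixedBoxCrossingQuenchedHarris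
import Summits.CriticalPhenomena.CardyFormulaZ2.Theorems.CardyIKTransportIKMixedBoxCrossingQuenchedCodeIff
import Summits.CriticalPhenomena.CardyFormulaZ2.Theorems.CardyIKTransportIKMixedBoxCrossingQuenchedVarianceDefs
import Summits.CriticalPhenomena.CardyFormulaZ2.Theorems.CardyIKTransportIKMixedBoxCrossingQuenchedMixture
import Summits.CriticalPhenomena.CardyFormulaZ2.Theorems.CardyIKTransportIKMixedBoxCrossingQuenchedAnnealedBound
import Summits.CriticalPhenomena.CardyFormulaZ2.Theorems.CardyIKTransportIKMixedBoxCrossingQuenchedFamOfVariance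
import Summits.CriticalPhenomena.CardyFormulaZ2.Theorems.CardyIKTransportIKMixedBoxCrossingQuenchedResidue

/-!
# SKELETON v8 of the line `defect-closure-exploration` (lead c7; owned unchanged by lead c8 as v8c) = merger with the strategist's ALT line `quenched-chain-fkg`,
# crux `IKMixedBoxCrossing` (stmt-CriticalPhenomena-5911) — v8c: EXACTLY TWO OPEN STUBS, S4 and (V)

COMPOSITION (all vocabulary LANDED: `…QuenchedDefs` p162432, `…QuenchedMixtureDefs` p164532, `…QuenchedVarianceDefs` p165525):

  crux ⇐ `Split.HorizontalClause` (p143979)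
       ⇐ `TallEasyTransverse` (S4, OPEN) ∧ `ApproxHarrisFam`                       [`horizontalClause_of_quenchedStubs`, QuenchedDefs]
           via `SquaresFromTall` (LANDED p165293), `Harris7OfFam` (LANDED p164097), `RSWAssembly` (LANDED p165305)
           [helpers LANDED: `glueStep` p163709, `bottomRowFloor` p164458];
  `ApproxHarrisFam` ⇐ `QuenchedMixture` (M, LANDED p166095) ∧ `QuenchedLogSupermodular` (L, LANDED p165332) ∧
           (`QuenchedLogSupermodular → QuenchedHarris`) (H, LANDED p165307) ∧ `ApproxHarrisFamOfVariance` (F, LANDED) ∧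
           `QuenchedVarianceDecay` (V, OPEN — the concentration statement)        [`approxHarrisFam_of_quenchedLayer`, QuenchedVarianceDefs];
  also LANDED: `CodeIff` (C, p165333); `QuenchedMixture → QuenchedHarris → AnnealedQuenchedBound` (A, LANDED p165674).

OPEN, honestly: `stub_tallEasyTransverse` (the anisotropy floor in its weakest form; memo c7 §10.3/§10.7/§10.8: the natural output of a
Grimmett–Manolescu-type transverse transport, now SUFFICIENT given `ApproxHarrisFam`; or the pinned window-to-window arm bound (R∗) fed to
Köhler-Schindler–Tassion Thm 3 for the FKG quenched measures) and `stub_quenchedVarianceDecay` (card `Lines/quenched-chain-fkg.md` §3).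
DISPROOF respected: association is used only quenched; `SquareTransverseHalf`/extremality forms are not used (refuted numerically, memo §1).
-/

namespace Summit.CriticalPhenomena.CardyFormulaZ2.Cruxes.IKMixedBoxCrossing.QuenchedChainFKG

/-- STUB v8-1 (OPEN · anisotropy, weakest form): an `n`-wide, `K₀ n`-tall box is crossed the short way with probability ≥ δ, every pattern. -/
theorem stub_tallEasyTransverse : TallEasyTransverse := by
  sorry

/-- STUB v8-2 (OPEN · the concentration statement (V)): the environment variance of quenched crossing probabilities of `n`-boxes → 0
uniformly in the pattern. -/
theorem stub_quenchedVarianceDecay : QuenchedVarianceDecay := by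
  sorry

/-- `ApproxHarrisFam` from the quenched layer: (M) (L) (H) (F) LANDED; only (V) is a stub. -/
theorem approxHarrisFam_proof : ApproxHarrisFam :=
  approxHarrisFam_of_quenchedLayer stub_quenchedMixture stub_quenchedLogSupermodular stub_quenchedHarris
    stub_approxHarrisFamOfVariance stub_quenchedVarianceDecay

/-- **THE LINE CLOSES THE CRUX modulo its stubs** (payload-route decl, by name): `SquaresFromTall`, `Harris7OfFam`, `RSWAssembly` are LANDED. -/
theorem IKMixedBoxCrossing_of :
    Summit.CriticalPhenomena.CardyFormulaZ2.Theses.CardyIKTransport.IKMixedBoxCrossing :=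
  Split.IKMixedBoxCrossing_of_horizontal (horizontalClause_of_quenchedStubs stub_tallEasyTransverse approxHarrisFam_proof
    stub_squaresFromTall stub_harris7OfFam stub_rswAssembly)

/-- The same for the home-route copy of the decl (CardyDiluteOrbit). -/
theorem IKMixedBoxCrossing_of_diluteOrbit :
    Summit.CriticalPhenomena.CardyFormulaZ2.Theses.CardyDiluteOrbit.IKMixedBoxCrossing :=
  Split.IKMixedBoxCrossing_of_horizontal_diluteOrbit (horizontalClause_of_quenchedStubs stub_tallEasyTransverse
    approxHarrisFam_proof stub_squaresFromTall stub_harris7OfFam stub_rswAssembly)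

end Summit.CriticalPhenomena.CardyFormulaZ2.Cruxes.IKMixedBoxCrossing.QuenchedChainFKG
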